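import Summits.AtomisticToContinuum.HydrodynamicLimit.Theses.CollisionIsometryCLT
import Literature.MathematicalPhysics.KineticTheory.HardSphereEulerProofs

/-!
# Sketch — crux-ideate stmt-AtomisticToContinuum-9519 (`AprioriBounds`), round 1, ideator 1

First lemmas of the two idea cards (`commutator-matched-bootstrap`, `visit-ledger-upscattering`)
and the pre-shock restatement both cards conclude (REPAIR recommendation; the crux as typed, with
`∀ t > 0` and `σ₀, λ` chosen before `N`, is suspect-false by post-shock Guderley focusing — see
NOTES.md ## Barrier notes §1). Everything is stated over existing declarations; nothing here is a
route item.
-/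

noncomputable section

open MeasureTheory Filter Set Topology
open scoped ENNReal

namespace Summit.AtomisticToContinuum.HydrodynamicLimit.Cruxes.AprioriBounds.IdeatorOne

open Literature.MathematicalPhysics.KineticTheory Literature.Analysis.FluidPDE

/-! ## The pre-shock restatement (what both lines conclude) -/

/-- `AprioriBoundsPreShock`: the body of `AprioriBounds` (stmt-9519) under the conjunct's prefix
(classical hs-Euler solution on `[0,T)`, LLN at `t = 0`, `t ∈ (0,T)`), i.e. the prefix of
`MaxSpeedBoundPreShock` (stmt-9511). This is what the Assembly (stmt-11094) consumes. -/
def AprioriBoundsPreShock : Prop :=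
  ∀ (a₀ θ₀ : T3 → ℝ) (u₀ : T3 → V3), Continuous a₀ → Continuous θ₀ → Continuous u₀ →
    (∀ x, 0 < a₀ x) → (∀ x, 0 < θ₀ x) →
    ∃ σ₀ : ℝ, 0 < σ₀ ∧ ∀ σ : ℝ, 0 < σ → σ < σ₀ →
      ∀ (T : ℝ) (ρ θ : ℝ → T3 → ℝ) (u : ℝ → T3 → V3), IsHardSphereEulerSolution σ T ρ u θ →
      ∀ Φ : (N : ℕ) → HardSphereFlow (Torus.geometry (Fin 3)) (hsDiameter σ N) (N + 1),
        TendstoHydroFieldsAt (fun N => localGibbsLaw σ a₀ u₀ θ₀ N (Φ N)) Φ ρ u θ 0 →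
        ∀ t ∈ Ico 0 T, 0 < t →
          (∃ lam Cexp : ℝ, 0 < lam ∧ Tendsto (fun N : ℕ => localGibbsLaw σ a₀ u₀ θ₀ N (Φ N)
            {z | Cexp < ∫ s in Icc 0 t, ∫ y, Real.exp (lam * ‖y.2‖ ^ 2)
              ∂(empiricalMeasure ((Φ N).flow s z))}) atTop (𝓝 0)) ∧
          (∀ (γ C : ℝ) (φ : ℕ → T3 → ℝ), 0 < γ → γ ≤ 1 / 15 →
            ((∀ N, Literature.Analysis.FunctionSpaces.Torus.IsSmooth (φ N)) ∧ (∀ N y, 0 ≤ φ N y) ∧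
              (∀ N, ∫ y, φ N y = 1) ∧
              (∀ (N : ℕ) y, ((N : ℝ) + 1) ^ (-γ) ≤ Torus.euclidDist y 0 → φ N y = 0) ∧
              (∀ (N : ℕ) y, φ N y ≤ C * ((N : ℝ) + 1) ^ (3 * γ)) ∧
              (∀ (N : ℕ) y, ‖Literature.Analysis.FunctionSpaces.Torus.gradient (φ N) y‖ ≤
                C * ((N : ℝ) + 1) ^ (4 * γ))) →
            ∃ c₁ : ℝ, 0 < c₁ ∧ Tendsto (fun N : ℕ => localGibbsLaw σ a₀ u₀ θ₀ N (Φ N)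
              {z | ∃ s ∈ Icc 0 t, ∃ x : T3,
                empiricalDensityField ((Φ N).flow s z) (fun y => φ N (y - x)) < c₁ ∨
                1 < empiricalDensityField ((Φ N).flow s z) (fun y => φ N (y - x)) * σ ^ 3})
              atTop (𝓝 0))

/-- Sanity: the crux as typed implies the pre-shock restatement (pure logic — the repair is a
weakening, so every consumer at `t < T` is unaffected). -/
theorem preShock_of_asTyped
    (h : Summit.AtomisticToContinuum.HydrodynamicLimit.Theses.CollisionIsometryCLT.AprioriBounds) :
    AprioriBoundsPreShock := by
  intro a₀ θ₀ u₀ ha hθ hu ha0 hθ0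
  obtain ⟨σ₀, hσ₀, H⟩ := h a₀ θ₀ u₀ ha hθ hu ha0 hθ0
  refine ⟨σ₀, hσ₀, fun σ hσ hσ' T ρ θ u _ Φ _ t _ ht => ?_⟩
  exact H σ hσ hσ' Φ t ht

/-! ## Card B (`visit-ledger-upscattering`): first lemmas -/

/-- B1 (initial visits are free; static, provable now from `lintegral_localGibbsMeasure`):
under the local Gibbs law the time-zero empirical exponential velocity moment at any rate
`λ` with `4λ sup θ₀ < 1` is bounded in probability by a deterministic constant (velocities are
independent Gaussians given the positions; Chebyshev at rate `2λ`). -/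
def InitialExpMomentBound : Prop :=
  ∀ (a₀ θ₀ : T3 → ℝ) (u₀ : T3 → V3), Continuous a₀ → Continuous θ₀ → Continuous u₀ →
    (∀ x, 0 < a₀ x) → (∀ x, 0 < θ₀ x) →
    ∀ σ : ℝ, 0 < σ → σ ≤ 1 / 2 →
    ∀ lam Θ : ℝ, 0 < lam → (∀ x, θ₀ x ≤ Θ) → 4 * lam * Θ < 1 →
      ∃ C : ℝ, Tendsto (fun N : ℕ => localGibbsMeasure σ a₀ u₀ θ₀ N
        {z | C < ∫ y, Real.exp (lam * ‖y.2‖ ^ 2) ∂(empiricalMeasure z)}) atTop (𝓝 0)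

/-- B2 (the VISIT LEDGER, deterministic, provable now): along a good trajectory the
time-integrated empirical exponential moment splits into visits — the initial visit of each
sphere (priced by the time-zero moment, since `|vᵢ|` is constant between the sphere's OWN
collisions), thermal visits (free: the flights of one sphere tile `[0,t]`, so all post-collisional
visits with outgoing energy `≤ K₀` cost at most `e^{λK₀} t`), and ENERGETIC ENTRIES (own-collision
times `τ ∈ (0,t]` with post-collisional `|vᵢ(τ)|² > K₀`), each weighted by its sojourn (time to
the sphere's next own collision, capped at `t`). Only the last sum needs statistics. -/
def VisitLedger : Prop :=
  ∀ (σ : ℝ) (N : ℕ) (Φ : HardSphereFlow (Torus.geometry (Fin 3)) (hsDiameter σ N) (N + 1))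
    (z : Config (N + 1) (Fin 3) T3), z ∈ Φ.good →
    ∀ (t lam K₀ : ℝ), 0 ≤ t → 0 ≤ lam →
      let own : Fin (N + 1) → Set ℝ := fun i => {τ | ∃ j : Fin (N + 1), j ≠ i ∧
        (Φ.flow τ z ∈ contactSet (Torus.geometry (Fin 3)) (N + 1) (hsDiameter σ N) i j ∨
         Φ.flow τ z ∈ contactSet (Torus.geometry (Fin 3)) (N + 1) (hsDiameter σ N) j i)}
      let sojourn : ℝ → Fin (N + 1) → ℝ := fun τ i => sInf ((own i ∩ Ioi τ) ∪ {t}) ⊓ t - τ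
      let E : ℝ → Fin (N + 1) → ℝ := fun τ i => ‖(Φ.flow τ z i).2‖ ^ 2
      ∫ s in Icc 0 t, ∫ y, Real.exp (lam * ‖y.2‖ ^ 2) ∂(empiricalMeasure (Φ.flow s z)) ≤
        t * ∫ y, Real.exp (lam * ‖y.2‖ ^ 2) ∂(empiricalMeasure z) + Real.exp (lam * K₀) * t +
        ((N + 1 : ℕ) : ℝ)⁻¹ * ∑ᶠ p ∈ {p : ℝ × Fin (N + 1) | p.1 ∈ own p.2 ∩ Ioc 0 t ∧ K₀ < E p.1 p.2},
          Real.exp (lam * E p.1 p.2) * sojourn p.1 p.2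

/-! ## Card A (`commutator-matched-bootstrap`): first lemmas (deterministic footprint moduli) -/

/-- A1 (spatial modulus of a kernel block density, provable now): for a smooth kernel supported in
the `h`-ball with `‖∇φ‖ ≤ L`, the block density is `L`-Lipschitz in the block centre, weighted by
the raw mass within `h + dist` — so a violation `ρ̄(x₀) < c₁` spreads to a ball of radius
`≍ c₁ σ³ h` once raw counts at scale `2h` are `≤ C σ⁻³ (N+1) h³` (the stopped window). -/
def BlockDensitySpatialModulus : Prop :=
  ∀ (N : ℕ) (z : Config (N + 1) (Fin 3) T3) (φ : T3 → ℝ) (L h : ℝ),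
    Literature.Analysis.FunctionSpaces.Torus.IsSmooth φ →
    (∀ y, ‖Literature.Analysis.FunctionSpaces.Torus.gradient φ y‖ ≤ L) →
    (∀ y, h ≤ Torus.euclidDist y 0 → φ y = 0) →
    ∀ x x' : T3,
      |empiricalDensityField z (fun y => φ (y - x)) - empiricalDensityField z (fun y => φ (y - x'))| ≤
        L * Torus.euclidDist x x' *
          empiricalDensityField z (fun y => if Torus.euclidDist y x < h + Torus.euclidDist x x' then 1 else 0)

/-- A2 (time modulus, provable now given energy conservation along the trajectory): the block
density of the evolved configuration is Lipschitz in time with constant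
`L · (2 E / (N+1))^{1/2}` (positions are continuous and piecewise linear; Cauchy–Schwarz and
conservation of `configEnergy`). With `L = C (N+1)^{4γ}` restricted to the mass in the `2h`-ball
this is the `N^{5γ/2}` time modulus of NOTES.md. -/
def BlockDensityTimeModulus : Prop :=
  ∀ (σ : ℝ) (N : ℕ) (Φ : HardSphereFlow (Torus.geometry (Fin 3)) (hsDiameter σ N) (N + 1))
    (z : Config (N + 1) (Fin 3) T3), z ∈ Φ.good →
    (∀ τ, configEnergy (Φ.flow τ z) = configEnergy z) →
    ∀ (φ : T3 → ℝ) (L : ℝ), Literature.Analysis.FunctionSpaces.Torus.IsSmooth φ →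
    (∀ y, ‖Literature.Analysis.FunctionSpaces.Torus.gradient φ y‖ ≤ L) →
    ∀ (x : T3) (s t : ℝ), s ≤ t →
      |empiricalDensityField (Φ.flow t z) (fun y => φ (y - x)) -
          empiricalDensityField (Φ.flow s z) (fun y => φ (y - x))| ≤
        L * (t - s) * Real.sqrt (2 * configEnergy z / ((N + 1 : ℕ) : ℝ))

end Summit.AtomisticToContinuum.HydrodynamicLimit.Cruxes.AprioriBounds.IdeatorOne

end
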